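import Mathlib.NumberTheory.DirichletCharacter.Orthogonality
import Mathlib.NumberTheory.LegendreSymbol.JacobiSymbol
import Mathlib.Analysis.SpecialFunctions.Pow.Real
import HarnessLib

/-!
# Heath-Brown's large sieve for real characters (the quadratic large sieve) and Liu's explicit form

Topic `Literature/NumberTheory/LFunctions` (namespace `Literature.NumberTheory.LFunctions`, grouping
sub-namespace `QuadraticLargeSieve`). STATEMENT LAYER (D-0014): the results below are deep theorems
vendored as sorry-free NAMED FACTS `def … : Prop` with page locators; nothing is asserted.

## Sources (statements read on the page, 2026-08-27)

* **D. R. Heath-Brown**, *A mean value estimate for real character sums*, Acta Arith. **72** (1995)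
  235–275 [HeathBrown1995QuadraticLargeSieve]: Theorem 1 and Corollary 1 (p. 237), Corollaries 2–4
  (p. 238). Notation of the paper: `Σ*` = a sum restricted to positive odd square-free
  integers, `(n/m)` the Jacobi symbol, `S(Q)` = the set of all real primitive characters of
  conductor at most `Q`.
  - Theorem 1: `Σ*_{m ≤ M} |Σ*_{n ≤ N} a_n (n/m)|² ≪_ε (MN)^ε (M + N) Σ*_{n ≤ N} |a_n|²`.
  - Corollary 2: `Σ_{χ ∈ S(Q)} |Σ_{n ≤ N} a_n χ(n)|² ≪_ε (QN)^ε (Q + N) Σ_{n₁ n₂ = □} |a_{n₁} a_{n₂}|`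
    (`n₁, n₂ ≤ N`).
  - Corollary 4: for `|a_m|, |b_n| ≤ 1`,
    `Σ_{m ≤ M, m odd} Σ_{n ≤ N} a_m b_n (n/m) ≪_ε (MN)^ε (M N^{1/2} + M^{1/2} N)`.
* **Z. Liu**, *Explicit quadratic large sieve inequality*, Acta Arith. **223** (2026) 227–252 =
  arXiv:2505.09637 [Liu2026ExplicitQuadraticLargeSieve], Theorem 1 (p. 4): with
  `Σ(M,N,a) = Σ*_{m ∼ M} |Σ*_{n ∼ N} a_n (n/m)|²` (`n ∼ N` meaning `N < n ≤ 2N`) and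
  `𝓑(M,N) = sup_{a ≠ 0} Σ(M,N,a)/‖a‖²`, there is an absolute `C > 0` with
  `𝓑(M,N) ≤ exp₄(C ε⁻¹) (MN)^ε (M + N)` for every `ε > 0` (`exp₄` = four-fold iterated exponential).
  "The estimate [of Heath-Brown] is optimal up to the magnitude of the `≪_ε`-constant" (p. 3).

## Rendering choices

* "`≪_ε`" = "for every `ε > 0` there is `C > 0` (depending on `ε` only) such that for all
  `M, N ≥ 1` and all coefficient sequences …"; Liu's theorem has the opposite quantifier order
  (`∃ C, ∀ ε`) with the explicit factor `Real.exp^[4] (C / ε)`.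
* `Σ*` over `n ≤ N` = the `Finset` `oddSquarefree N` = `{n ∈ [1, N] : n odd ∧ squarefree}`; the
  Jacobi symbol is Mathlib's `jacobiSym (n : ℤ) m`, cast to `ℂ`.
* A real primitive character of conductor `q` is a `DirichletCharacter ℂ q` that `IsPrimitive` and
  is `MulChar.IsQuadratic` (values in `{0, 1, −1}`; this includes the principal character mod `1`,
  as does `S(Q)`); `S(Q)` = the disjoint union over `1 ≤ q ≤ Q`; `χ(n)` = `χ (n : ZMod q)`.
* `Σ_{n₁ n₂ = □} |a_{n₁} a_{n₂}|` = the double sum over `1 ≤ n₁, n₂ ≤ N` with `IsSquare (n₁ n₂)`.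
* Corollary 4 is stated with `m` ranging over the odd `m ≤ M` written as
  `(range (M+1)).filter Odd` and `n` over `Icc 1 N`, complex coefficients of modulus `≤ 1`, exactly
  the binder shape of the registered consumer hypothesis `hHB` of
  `Summits/PneNP/PneNP/Cruxes/CircuitNpAcc0/Lines/SketchSeparableRung.lean` (real coefficients);
  the PROVED bridge `heathBrown1995_corollary4.real_form` delivers that hypothesis verbatim
  (including the degenerate `M = 0` / `N = 0` cases, where both sides vanish).
* Liu states Theorem 1 for real `M, N ≥ 1`; we take natural `M, N ≥ 1` and dyadic ranges
  `(M, 2M]`, `(N, 2N]`, the special case used in applications. TODO(general form): real `M, N`.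
* Deliberately NOT here: Heath-Brown's Corollaries 1 and 3 (immediate from Theorem 1 / Corollary
  2), Theorem 2 (the fourth moment `Σ_{χ ∈ S(Q)} |L(σ+it,χ)|⁴ ≪_ε {Q + (Q(|t|+1))^{2−2σ}}(Q(|t|+1))^ε`,
  no tree consumer names it), Liu's Corollaries 1–3, and any proof of the deep statements. Consumers in the tree cite these inequalities in prose only (2026-08-27: sketches under
  `Summits/Parity/BatemanHorn`, `Summits/PneNP`, `Summits/QuantumAdvantage`, and
  `Literature/NumberTheory/LFunctions/Zhang2022/RepairInPrintLengthsCeiling.lean`).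

The programme that requested this file SEARCHES and TYPES; nothing here is a claim about zeros of
`L`-functions.
-/

noncomputable section

open Finset

namespace Literature.NumberTheory.LFunctions

namespace QuadraticLargeSieve

/-- `Σ*`-range of Heath-Brown: the positive odd square-free integers `n ≤ N`.
[cite: HeathBrown1995QuadraticLargeSieve, §1 p. 237 (notation `Σ*`)] -/
def oddSquarefree (N : ℕ) : Finset ℕ :=
  (Icc 1 N).filter fun n => Odd n ∧ Squarefree n

/-- Dyadic `Σ*`-range of Liu: the odd square-free integers `n` with `N < n ≤ 2N` (`n ∼ N`).
[cite: Liu2026ExplicitQuadraticLargeSieve, §1.5 (notation `n ∼ N`) and Theorem 1] -/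
def oddSquarefreeDyadic (N : ℕ) : Finset ℕ :=
  (Ioc N (2 * N)).filter fun n => Odd n ∧ Squarefree n

/-- Membership in Heath-Brown's `Σ*`-range (unfolding lemma).
[cite: HeathBrown1995QuadraticLargeSieve, §1 p. 237 (notation `Σ*`)] -/
theorem mem_oddSquarefree {N n : ℕ} :
    n ∈ oddSquarefree N ↔ (1 ≤ n ∧ n ≤ N) ∧ Odd n ∧ Squarefree n := by
  simp [oddSquarefree]

/-- Membership in Liu's dyadic `Σ*`-range (unfolding lemma).
[cite: Liu2026ExplicitQuadraticLargeSieve, Theorem 1 (notation `n ∼ N`)] -/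
theorem mem_oddSquarefreeDyadic {N n : ℕ} :
    n ∈ oddSquarefreeDyadic N ↔ (N < n ∧ n ≤ 2 * N) ∧ Odd n ∧ Squarefree n := by
  simp [oddSquarefreeDyadic]

/-- Heath-Brown's mean square `Σ*_{m ≤ M} |Σ*_{n ≤ N} a_n (n/m)|²` of a real character sum with
Jacobi symbols. [cite: HeathBrown1995QuadraticLargeSieve, Theorem 1 (left-hand side)] -/
def jacobiMeanSquare (M N : ℕ) (a : ℕ → ℂ) : ℝ :=
  ∑ m ∈ oddSquarefree M, ‖∑ n ∈ oddSquarefree N, a n * (jacobiSym (n : ℤ) m : ℂ)‖ ^ 2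

/-- Liu's dyadic form `Σ(M,N,a) = Σ*_{m ∼ M} |Σ*_{n ∼ N} a_n (n/m)|²`.
[cite: Liu2026ExplicitQuadraticLargeSieve, Theorem 1 (definition of `Σ(M,N,a)`)] -/
def jacobiMeanSquareDyadic (M N : ℕ) (a : ℕ → ℂ) : ℝ :=
  ∑ m ∈ oddSquarefreeDyadic M, ‖∑ n ∈ oddSquarefreeDyadic N, a n * (jacobiSym (n : ℤ) m : ℂ)‖ ^ 2

open scoped Classical in
/-- The real (= quadratic-or-principal) primitive Dirichlet characters of conductor exactly `q`,
as characters mod `q`; `S(Q)` of Heath-Brown is their union over `q ≤ Q`.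
[cite: HeathBrown1995QuadraticLargeSieve, Corollary 1 (definition of `S(Q)`)] -/
def realPrimitive (q : ℕ) : Finset (DirichletCharacter ℂ q) :=
  univ.filter fun χ => χ.IsPrimitive ∧ MulChar.IsQuadratic χ

/-- `Σ_{χ ∈ S(Q)} |Σ_{n ≤ N} a_n χ(n)|²`: the mean square of a character sum over all real primitive
characters of conductor at most `Q`.
[cite: HeathBrown1995QuadraticLargeSieve, Corollary 2 (left-hand side)] -/
def charMeanSquare (Q N : ℕ) (a : ℕ → ℂ) : ℝ :=
  ∑ q ∈ Icc 1 Q, ∑ χ ∈ realPrimitive q, ‖∑ n ∈ Icc 1 N, a n * χ (n : ZMod q)‖ ^ 2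

/-- `Σ_{n₁ n₂ = □} |a_{n₁} a_{n₂}|` over `1 ≤ n₁, n₂ ≤ N`: Heath-Brown's replacement for `‖a‖²`
when the coefficients are not supported on square-free integers.
[cite: HeathBrown1995QuadraticLargeSieve, Corollary 2 (right-hand side)] -/
def squarePairSum (N : ℕ) (a : ℕ → ℂ) : ℝ :=
  ∑ n₁ ∈ Icc 1 N, ∑ n₂ ∈ (Icc 1 N).filter (fun n₂ => IsSquare (n₁ * n₂)), ‖a n₁ * a n₂‖

/-- The mean square of Theorem 1 is non-negative (sanity/API).
[cite: HeathBrown1995QuadraticLargeSieve, Theorem 1 (left-hand side)] -/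
theorem jacobiMeanSquare_nonneg (M N : ℕ) (a : ℕ → ℂ) : 0 ≤ jacobiMeanSquare M N a :=
  sum_nonneg fun _ _ => by positivity

/-- The character mean square of Corollary 2 is non-negative (sanity/API).
[cite: HeathBrown1995QuadraticLargeSieve, Corollary 2 (left-hand side)] -/
theorem charMeanSquare_nonneg (Q N : ℕ) (a : ℕ → ℂ) : 0 ≤ charMeanSquare Q N a :=
  sum_nonneg fun _ _ => sum_nonneg fun _ _ => by positivity

/-- `Σ_{n₁ n₂ = □} |a_{n₁} a_{n₂}| ≥ 0` (sanity/API).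
[cite: HeathBrown1995QuadraticLargeSieve, Corollary 2 (right-hand side)] -/
theorem squarePairSum_nonneg (N : ℕ) (a : ℕ → ℂ) : 0 ≤ squarePairSum N a :=
  sum_nonneg fun _ _ => sum_nonneg fun _ _ => norm_nonneg _

end QuadraticLargeSieve

open QuadraticLargeSieve

/-- **Heath-Brown 1995, Theorem 1** (the large sieve for real characters). "Let `M, N` be positive
integers, and let `a₁, …, a_N` be arbitrary complex numbers. Then
`Σ*_{m ≤ M} |Σ*_{n ≤ N} a_n (n/m)|² ≪_ε (MN)^ε (M + N) Σ*_{n ≤ N} |a_n|²` for any `ε > 0`",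
`Σ*` running over positive odd square-free integers and `(n/m)` the Jacobi symbol. Rendered with
the `ε`-dependent implied constant made explicit as `C = C(ε)`.
[cite: HeathBrown1995QuadraticLargeSieve, Theorem 1 (p. 237)] -/
def heathBrown1995_theorem1 : Prop :=
  ∀ ε : ℝ, 0 < ε → ∃ C : ℝ, 0 < C ∧ ∀ M N : ℕ, 1 ≤ M → 1 ≤ N → ∀ a : ℕ → ℂ,
    jacobiMeanSquare M N a ≤
      C * (((M : ℝ) * N) ^ ε * ((M : ℝ) + N)) * ∑ n ∈ oddSquarefree N, ‖a n‖ ^ 2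

/-- **Heath-Brown 1995, Corollary 2.** "Let `N, Q` be positive integers, and let `a₁, …, a_N` be
arbitrary complex numbers. Let `S(Q)` denote the set of all real primitive characters of conductor
at most `Q`. Then `Σ_{χ ∈ S(Q)} |Σ_{n ≤ N} a_n χ(n)|² ≪_ε (QN)^ε (Q + N) Σ_{n₁ n₂ = □} |a_{n₁} a_{n₂}|`
for any `ε > 0`" (the sum on the right over `n₁, n₂ ≤ N` with `n₁ n₂` a perfect square). This is
the form usually quoted as "the quadratic large sieve"; for coefficients supported on square-free
`n` the right-hand side is `(QN)^ε (Q + N) ‖a‖²`.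
[cite: HeathBrown1995QuadraticLargeSieve, Corollary 2 (p. 238)] -/
def heathBrown1995_corollary2 : Prop :=
  ∀ ε : ℝ, 0 < ε → ∃ C : ℝ, 0 < C ∧ ∀ Q N : ℕ, 1 ≤ Q → 1 ≤ N → ∀ a : ℕ → ℂ,
    charMeanSquare Q N a ≤ C * (((Q : ℝ) * N) ^ ε * ((Q : ℝ) + N)) * squarePairSum N a

/-- **Heath-Brown 1995, Corollary 4** (bilinear form). "Let `M, N` be positive integers, and let
`a₁, …, a_M` and `b₁, …, b_N` be arbitrary complex numbers satisfying `|a_m|, |b_n| ≤ 1`. Then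
`Σ_{m ≤ M, m odd} Σ_{n ≤ N} a_m b_n (n/m) ≪_ε (MN)^ε (M N^{1/2} + M^{1/2} N)` for any `ε > 0`"
(`m` odd but not necessarily square-free, `n` unrestricted). The odd `m ≤ M` are written
`(range (M+1)).filter Odd` (= the odd `1 ≤ m ≤ M`, since `0` is even) to match the consumer
hypothesis in `Summits/PneNP/…/SketchSeparableRung.lean`; see `heathBrown1995_corollary4.real_form`.
[cite: HeathBrown1995QuadraticLargeSieve, Corollary 4 (p. 238)] -/
def heathBrown1995_corollary4 : Prop :=
  ∀ ε : ℝ, 0 < ε → ∃ C : ℝ, 0 < C ∧ ∀ M N : ℕ, 1 ≤ M → 1 ≤ N → ∀ a b : ℕ → ℂ,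
    (∀ m, ‖a m‖ ≤ 1) → (∀ n, ‖b n‖ ≤ 1) →
      ‖∑ m ∈ (range (M + 1)).filter (fun m => Odd m), ∑ n ∈ Icc 1 N,
          a m * b n * (jacobiSym (n : ℤ) m : ℂ)‖ ≤
        C * ((M : ℝ) * N) ^ ε * ((M : ℝ) * Real.sqrt N + Real.sqrt M * (N : ℝ))

/-- **Liu 2026, Theorem 1** (explicit quadratic large sieve). "Let `M, N ≥ 1` and `{a_n}_{n ∼ N}` be
a sequence of complex numbers. Define `Σ(M,N,a) = Σ*_{m ∼ M} |Σ*_{n ∼ N} a_n (n/m)|²`,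
`𝓑(M,N) = sup_{‖a‖ ≠ 0} Σ(M,N,a)/‖a‖²`. Then there exists a constant `C > 0` such that for every
`ε > 0`, we have `𝓑(M,N) ≤ exp₄(C ε⁻¹) · (MN)^ε (M + N)`, where `exp_k` refers to the `k`'th
iterated exponential." Rendered for natural `M, N ≥ 1` (dyadic ranges `(M, 2M]`, `(N, 2N]`) with
`‖a‖² = Σ_{N < n ≤ 2N} |a_n|²` and `exp₄ = Real.exp^[4]`; the supremum is unfolded into a bound
for every `a`. TODO(general form): real `M, N ≥ 1`.
[cite: Liu2026ExplicitQuadraticLargeSieve, Theorem 1 (p. 4)] -/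
def liu2026_theorem1 : Prop :=
  ∃ C : ℝ, 0 < C ∧ ∀ ε : ℝ, 0 < ε → ∀ M N : ℕ, 1 ≤ M → 1 ≤ N → ∀ a : ℕ → ℂ,
    jacobiMeanSquareDyadic M N a ≤
      Real.exp^[4] (C / ε) * ((((M : ℝ) * N) ^ ε) * ((M : ℝ) + N)) *
        ∑ n ∈ Ioc N (2 * N), ‖a n‖ ^ 2

/-- Liu's explicit theorem implies the dyadic form of Heath-Brown's Theorem 1 with an `ε`-dependent
constant (the trivial direction: specialise the absolute `C` at each `ε`).
[cite: Liu2026ExplicitQuadraticLargeSieve, §1.2 (Theorem 1 as an explicit form of (1.6))] -/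
theorem liu2026_theorem1.dyadic_heathBrown (h : liu2026_theorem1) :
    ∀ ε : ℝ, 0 < ε → ∃ C : ℝ, 0 < C ∧ ∀ M N : ℕ, 1 ≤ M → 1 ≤ N → ∀ a : ℕ → ℂ,
      jacobiMeanSquareDyadic M N a ≤
        C * ((((M : ℝ) * N) ^ ε) * ((M : ℝ) + N)) * ∑ n ∈ Ioc N (2 * N), ‖a n‖ ^ 2 := by
  obtain ⟨C, -, hmain⟩ := h
  intro ε hε
  refine ⟨Real.exp^[4] (C / ε), ?_, fun M N hM hN a => hmain ε hε M N hM hN a⟩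
  simp only [Function.iterate_succ, Function.iterate_zero, Function.comp_apply, id_eq]
  exact Real.exp_pos _

/-- **Bridge to the registered consumer.** Heath-Brown's Corollary 4 (complex coefficients,
`M, N ≥ 1`, `C > 0`) implies VERBATIM the real-coefficient hypothesis `hHB` of the rung stub
`stub_separable_bilinear_bound` in `Summits/PneNP/PneNP/Cruxes/CircuitNpAcc0/Lines/SketchSeparableRung.lean`
(all `M, N : ℕ`, no positivity of `C` recorded): embed `ℝ ↪ ℂ`, and note that for `M = 0` or
`N = 0` both sides vanish (`0 ^ ε = 0` for `ε > 0`).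
[cite: HeathBrown1995QuadraticLargeSieve, Corollary 4 (p. 238)] -/
theorem heathBrown1995_corollary4.real_form (h : heathBrown1995_corollary4) :
    ∀ ε : ℝ, 0 < ε → ∃ C : ℝ, ∀ (M N : ℕ) (a b : ℕ → ℝ), (∀ m, |a m| ≤ 1) → (∀ k, |b k| ≤ 1) →
      |∑ m ∈ (range (M + 1)).filter (fun m => Odd m), ∑ k ∈ Icc 1 N,
          a m * b k * (jacobiSym (k : ℤ) m : ℝ)| ≤
        C * ((M : ℝ) * N) ^ ε * ((M : ℝ) * Real.sqrt N + Real.sqrt M * N) := by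
  intro ε hε
  obtain ⟨C, -, hmain⟩ := h ε hε
  refine ⟨C, fun M N a b ha hb => ?_⟩
  rcases Nat.eq_zero_or_pos M with hM | hM
  · subst hM
    have h0 : (range (0 + 1)).filter (fun m => Odd m) = ∅ := by
      ext m
      simp only [zero_add, range_one, mem_filter, mem_singleton, notMem_empty, iff_false, not_and]
      rintro rfl
      decide
    rw [h0, sum_empty, abs_zero, Nat.cast_zero, zero_mul, Real.zero_rpow hε.ne']
    simp
  rcases Nat.eq_zero_or_pos N with hN | hN
  · subst hN
    simp [Real.zero_rpow hε.ne']
  have ha' : ∀ m, ‖(a m : ℂ)‖ ≤ 1 := fun m => by simpa [Complex.norm_real, Real.norm_eq_abs] using ha m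
  have hb' : ∀ k, ‖(b k : ℂ)‖ ≤ 1 := fun k => by simpa [Complex.norm_real, Real.norm_eq_abs] using hb k
  have key := hmain M N hM hN (fun m => (a m : ℂ)) (fun k => (b k : ℂ)) ha' hb'
  have hcast : (∑ m ∈ (range (M + 1)).filter (fun m => Odd m), ∑ k ∈ Icc 1 N,
          (a m : ℂ) * (b k : ℂ) * (jacobiSym (k : ℤ) m : ℂ)) =
        ((∑ m ∈ (range (M + 1)).filter (fun m => Odd m), ∑ k ∈ Icc 1 N,
          a m * b k * (jacobiSym (k : ℤ) m : ℝ) : ℝ) : ℂ) := by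
    push_cast
    rfl
  rw [hcast, Complex.norm_real, Real.norm_eq_abs] at key
  simpa using key

end Literature.NumberTheory.LFunctions
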